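import Mathlib.Analysis.SpecialFunctions.Pow.Real
import Mathlib.Data.Complex.Basic
import HarnessLib

/-!
# K2-LIT E3 · #20′ ROAD «K-EP», SECOND BRICK — file `K2E3EPFunctionValueAtOneDepthZero`: the VALUE AT ONE of the 3-term Euler–Poincaré function as a COUNT,
# and the DEPTH-ZERO IWAHORI-SPHERICAL numbers (`π²(ξ₀)`: `q³∕(q³+1) + 1∕(q+1) − 1 = (q³ − q)∕((q³+1)(q+1)) > 0`; Steinberg: `−1 + 0 + 0 < 0`)

Cell `pub/hodgecm-mathlib` (D-0151), Track B «K2-LIT» engine E3, socket item `stmt-HodgeConjecture-24833` (h413; lane `--supports … --as helper`; count-neutral);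
seat `hodgecm-mathlib-K2E3-p15` (g0); dealer K2E3-plan (g1) 23:40:43Z (e) «#20′ ROAD K-EP: second brick ↦ K2E3-p15» after K2E3-p20 (g2)'s planning remark 23:36:34Z and
K2E3-p17 (g2)'s first brick `K2E3EPFunctionValueAtOne` (`f 1 = ν(P₀)⁻¹·finrank V^{U(head d₁)} + ν(P₂)⁻¹·finrank V^{U(tail d₁)} − ν(P₁)⁻¹·finrank V^{U(head)⊔U(tail)}`).
THEOREMS ONLY (no definition ∕ instance ∕ notation ∕ named fact ∕ `sorry`); Mathlib-only imports (pure arithmetic: it docks on brick 1 by `rw`).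
Namespace `Summit.HodgeConjecture.HodgeConjecture.Cruxes.H413.K2E3EPFunctionValueAtOneDepthZero`.

THE MATHEMATICS ([Rogawski1990 §12.6 p. 187: «`f_π(1) = d(π)`, the formal degree»; SchneiderStuhler1997 §III.4; Kottwitz1988 §2]).  For the K1 Euler–Poincaré function
`f = ν(P₀)⁻¹•f₀ + ν(P₂)⁻¹•f₂ − ν(P₁)⁻¹•f₁` of an irreducible smooth `π` on the `U(Φ₃)(L⁺_v)` tree (vertex stabilisers `P₀ ⊇ P₁ ⊆ P₂`, `P₁` the edge stabiliser, `fᵢ(1) =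
χ_{τᵢ}(1) = dᵢ := dim V^{Uᵢ}`), Haar measure gives `ν(P₀) = [P₀:P₁]·ν(P₁)`, `ν(P₂) = [P₂:P₁]·ν(P₁)`, so with `a = [P₀:P₁]`, `b = [P₂:P₁]`:
`f(1)·ν(P₁) = d₀∕a + d₂∕b − d₁`, hence **POS-ONE(π) ⟺ `a·b·d₁ < b·d₀ + a·d₂`** — a K-TYPE DIMENSION INEQUALITY, no harmonic analysis (p20's reading).
* §1 `epValue_eq_ofReal`, `re_epValue_mul_eq`, `im_epValue_eq_zero`, **`epValue_re_pos_iff_count`** — the value-at-one arithmetic for real `ν₁ > 0`, naturals `a b ≥ 1`, `d₀ d₂ d₁`.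
* §2 THE DEPTH-ZERO NUMBERS at an unramified place (`[K₀:I] = q³+1`, `[K₁:I] = q+1`): **`depthZero_pi2_count`** — for the Iwahori-spherical `L²` class `π²(ξ₀) ≠ St`
  (`d₀ = q³` = dim St_{U₃(𝔽_q)} on `V^{U₁(K₀)}`, `d₂ = 1`, `d₁ = 1`): `(q³+1)(q+1)·1 < (q+1)·q³ + (q³+1)·1` (⟺ `q < q³`, `q ≥ 2`), with the exact value
  **`depthZero_pi2_value`** `q³∕(q³+1) + 1∕(q+1) − 1 = (q³ − q)∕((q³+1)(q+1))` and its positivity; the STEINBERG companion **`depthZero_st_count`** (`d = (0, 0, 1)`: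
  `¬ a·b·1 < b·0 + a·0`, i.e. `f_EP(1) < 0` — the pseudo-coefficient is `−f_EP`, matching ★ (G3) `epValueAtOne_neg` ∕ ★ p855566 §3).
* §3 **`epValue_re_pos_of_depthZero_pi2`** — §1 + §2 assembled: `0 < (f 1).re ∧ (f 1).im = 0` from the two index relations and the three finrank identities (HYPOTHESES).
HONEST RESIDUE (third brick, not this file): the three finrank identities for `π²(ξ₀)` — `dim π²(ξ₀)^{U₁(K₀)} = q³`, `dim π²(ξ₀)^{U₁(K₁)} = 1`, `dim π²(ξ₀)^{U₁(K₀)⊔U₁(K₁)} = 1`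
(Moy–Prasad depth zero ∕ `i(χ₀)^{U₁(K₀)} = 1 ⊕ St_{U₃(𝔽_q)}`, `πⁿ(ξ₀)` spherical; over ★ PS-LEVELS `finrank_fixedPoints_cmPrincipalSeries_K0∕K1∕I`, ★ `K2E3PSIwahoriBasis`, ★ MACKEY,
★ `FixedVectorsRankAdditive`) and the two index facts (★ unramified level indices of (G3)).
HONEST LABEL: count-neutral helper; HC_CM is proved only modulo the 7 printed citations (2 remaining named inputs hLiu418 = `stmt-HodgeConjecture-24832`, h413 =
`stmt-HodgeConjecture-24833`) until rung 0 closes; nothing printed is asserted here.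

## References
* [Rogawski1990] J. D. Rogawski, *Automorphic Representations of Unitary Groups in Three Variables* (1990): §12.6 p. 187 («`f_π(1) = d(π)`»), Prop. 12.6.1 (a) p. 188.
* [SchneiderStuhler1997] P. Schneider, U. Stuhler, Publ. Math. IHÉS 85 (1997): §III.4 (Euler–Poincaré functions).
* [Kottwitz1988] R. E. Kottwitz, *Tamagawa numbers*, Ann. of Math. 127 (1988): §2 (`f_EP(1)` and the Euler–Poincaré measure).
* [Tits1979] J. Tits, PSPM 33.1 (1979), §3.5 (the unramified `U₃`: local indices `(q³+1, q+1)`).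
-/

set_option autoImplicit false
-- the mandated namespace has the single-problem summit's repeated segment (`HodgeConjecture.HodgeConjecture`)
set_option linter.dupNamespace false

namespace Summit.HodgeConjecture.HodgeConjecture.Cruxes.H413.K2E3EPFunctionValueAtOneDepthZero

/-! ## §1 The value at one of the 3-term EP function as a count -/

/-- **The value at one is the real number `d₀∕(a ν₁) + d₂∕(b ν₁) − d₁∕ν₁`** (`f(1) = ν(P₀)⁻¹ d₀ + ν(P₂)⁻¹ d₂ − ν(P₁)⁻¹ d₁`, `ν(P₀) = a·ν(P₁)`, `ν(P₂) = b·ν(P₁)`).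
[cite: Kottwitz1988, §2] [cite: SchneiderStuhler1997, §III.4] -/
theorem epValue_eq_ofReal {ν₁ : ℝ} {a b : ℕ} (d₀ d₂ d₁ : ℕ) {f1 : ℂ}
    (hf1 : f1 = (((a : ℝ) * ν₁ : ℝ) : ℂ)⁻¹ * (d₀ : ℂ) + (((b : ℝ) * ν₁ : ℝ) : ℂ)⁻¹ * (d₂ : ℂ) - ((ν₁ : ℝ) : ℂ)⁻¹ * (d₁ : ℂ)) :
    f1 = (((d₀ : ℝ) / ((a : ℝ) * ν₁) + (d₂ : ℝ) / ((b : ℝ) * ν₁) - (d₁ : ℝ) / ν₁ : ℝ) : ℂ) := by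
  rw [hf1]
  push_cast
  ring

/-- **`f(1)·ν(P₁) = d₀∕a + d₂∕b − d₁`** (real part; `ν(P₁) > 0`). [cite: Kottwitz1988, §2] [cite: SchneiderStuhler1997, §III.4] -/
theorem re_epValue_mul_eq {ν₁ : ℝ} (hν₁ : 0 < ν₁) {a b : ℕ} (ha : 0 < a) (hb : 0 < b) (d₀ d₂ d₁ : ℕ) {f1 : ℂ}
    (hf1 : f1 = (((a : ℝ) * ν₁ : ℝ) : ℂ)⁻¹ * (d₀ : ℂ) + (((b : ℝ) * ν₁ : ℝ) : ℂ)⁻¹ * (d₂ : ℂ) - ((ν₁ : ℝ) : ℂ)⁻¹ * (d₁ : ℂ)) :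
    f1.re * ν₁ = (d₀ : ℝ) / a + (d₂ : ℝ) / b - d₁ := by
  have ha' : (a : ℝ) ≠ 0 := Nat.cast_ne_zero.2 ha.ne'
  have hb' : (b : ℝ) ≠ 0 := Nat.cast_ne_zero.2 hb.ne'
  have hν' : ν₁ ≠ 0 := hν₁.ne'
  rw [epValue_eq_ofReal d₀ d₂ d₁ hf1, Complex.ofReal_re]
  field_simp

/-- **The value at one is real**: `(f 1).im = 0`. [cite: Kottwitz1988, §2] -/
theorem im_epValue_eq_zero {ν₁ : ℝ} {a b : ℕ} (d₀ d₂ d₁ : ℕ) {f1 : ℂ}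
    (hf1 : f1 = (((a : ℝ) * ν₁ : ℝ) : ℂ)⁻¹ * (d₀ : ℂ) + (((b : ℝ) * ν₁ : ℝ) : ℂ)⁻¹ * (d₂ : ℂ) - ((ν₁ : ℝ) : ℂ)⁻¹ * (d₁ : ℂ)) :
    f1.im = 0 := by
  rw [epValue_eq_ofReal d₀ d₂ d₁ hf1, Complex.ofReal_im]

/-- **POS-ONE ⟺ A K-TYPE DIMENSION INEQUALITY**: `0 < (f 1).re ⟺ a·b·d₁ < b·d₀ + a·d₂` (denominators cleared; `ν(P₁) > 0`).  This is K2E3-p20 (g2)'s reading of the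
formal-degree positivity `f_π(1) = d(π) > 0` on the K-type Euler–Poincaré road. [cite: Rogawski1990, §12.6 p. 187] [cite: Kottwitz1988, §2] -/
theorem epValue_re_pos_iff_count {ν₁ : ℝ} (hν₁ : 0 < ν₁) {a b : ℕ} (ha : 0 < a) (hb : 0 < b) (d₀ d₂ d₁ : ℕ) {f1 : ℂ}
    (hf1 : f1 = (((a : ℝ) * ν₁ : ℝ) : ℂ)⁻¹ * (d₀ : ℂ) + (((b : ℝ) * ν₁ : ℝ) : ℂ)⁻¹ * (d₂ : ℂ) - ((ν₁ : ℝ) : ℂ)⁻¹ * (d₁ : ℂ)) :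
    0 < f1.re ↔ a * b * d₁ < b * d₀ + a * d₂ := by
  have hmul := re_epValue_mul_eq hν₁ ha hb d₀ d₂ d₁ hf1
  have ha' : (0 : ℝ) < a := Nat.cast_pos.2 ha
  have hb' : (0 : ℝ) < b := Nat.cast_pos.2 hb
  have key : f1.re * ν₁ * ((a : ℝ) * b) = (b : ℝ) * d₀ + (a : ℝ) * d₂ - (a : ℝ) * b * d₁ := by
    rw [hmul]
    field_simp
  have hiff : 0 < f1.re ↔ 0 < f1.re * ν₁ * ((a : ℝ) * b) := by
    constructor
    · intro h; positivity
    · intro h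
      by_contra hle
      push Not at hle
      have : f1.re * ν₁ * ((a : ℝ) * b) ≤ 0 := by
        rw [mul_assoc]
        exact mul_nonpos_of_nonpos_of_nonneg hle (by positivity)
      linarith
  rw [hiff, key]
  constructor
  · intro h
    have h' : ((a * b * d₁ : ℕ) : ℝ) < ((b * d₀ + a * d₂ : ℕ) : ℝ) := by push_cast; linarith
    exact_mod_cast h'
  · intro hlt
    have h' : ((a * b * d₁ : ℕ) : ℝ) < ((b * d₀ + a * d₂ : ℕ) : ℝ) := by exact_mod_cast hlt
    push_cast at h'
    linarith

/-! ## §2 The depth-zero numbers at an unramified place: `[K₀:I] = q³ + 1`, `[K₁:I] = q + 1` -/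

/-- **THE IWAHORI-SPHERICAL `L²` CLASS `π²(ξ₀)` AT DEPTH ZERO**: with `d₀ = q³` (the Steinberg representation of `U₃(𝔽_q)` on `V^{U₁(K₀)}`), `d₂ = 1`, `d₁ = 1` and the
unramified indices `a = q³ + 1`, `b = q + 1`, the count inequality holds for `q ≥ 2`: `(q³+1)(q+1)·1 < (q+1)·q³ + (q³+1)·1` (⟺ `q < q³`). [cite: Tits1979, §3.5]
[cite: Rogawski1990, §12.6 p. 187] -/
theorem depthZero_pi2_count (q : ℕ) (hq : 2 ≤ q) :
    (q ^ 3 + 1) * (q + 1) * 1 < (q + 1) * q ^ 3 + (q ^ 3 + 1) * 1 := by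
  have hq3 : q < q ^ 3 := by
    calc q = q * 1 * 1 := by ring
      _ < q * q * q := by
        have h1 : 1 < q := hq
        have hq0 : 0 < q := by omega
        nlinarith [Nat.mul_lt_mul_of_lt_of_le' h1 (le_refl q) hq0]
      _ = q ^ 3 := by ring
  nlinarith

/-- **THE EXACT VALUE** `q³∕(q³+1) + 1∕(q+1) − 1 = (q³ − q)∕((q³+1)(q+1))` (real arithmetic), K2E3-p20 (g2)'s worked check. [cite: Tits1979, §3.5] -/
theorem depthZero_pi2_value (q : ℝ) (hq : 0 ≤ q) :
    q ^ 3 / (q ^ 3 + 1) + 1 / (q + 1) - 1 = (q ^ 3 - q) / ((q ^ 3 + 1) * (q + 1)) := by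
  have h1 : q ^ 3 + 1 ≠ 0 := by positivity
  have h2 : q + 1 ≠ 0 := by positivity
  field_simp
  ring

/-- **… AND ITS POSITIVITY** for `q ≥ 2` (indeed `q > 1`): `0 < q³∕(q³+1) + 1∕(q+1) − 1`. [cite: Tits1979, §3.5] [cite: Rogawski1990, §12.6 p. 187] -/
theorem depthZero_pi2_value_pos (q : ℝ) (hq : 1 < q) :
    0 < q ^ 3 / (q ^ 3 + 1) + 1 / (q + 1) - 1 := by
  rw [depthZero_pi2_value q (by linarith)]
  have hnum : 0 < q ^ 3 - q := by nlinarith [sq_nonneg q, mul_pos (by linarith : (0 : ℝ) < q) (by nlinarith : (0 : ℝ) < q ^ 2 - 1)]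
  positivity

/-- **THE STEINBERG COMPANION at depth zero** (`d = (0, 0, 1)`: no `K₀`- or `K₁`-level-one spherical part, one Iwahori line): the count inequality FAILS,
i.e. `f_EP(1) < 0` — the pseudo-coefficient of `St` is `−f_EP` (consistent with ★ (G3) `epValueAtOne_neg` and ★ `K2E3DiscretePlancherelPinsSteinberg` §3).
[cite: Kottwitz1988, §2] [cite: Rogawski1990, §12.6 p. 187] -/
theorem depthZero_st_count (a b : ℕ) (ha : 0 < a) (hb : 0 < b) : ¬ a * b * 1 < b * 0 + a * 0 := by
  have : 0 < a * b := Nat.mul_pos ha hb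
  omega

/-! ## §3 Assembly: POS-ONE for `π²(ξ₀)` at depth zero from the two index relations and the three finrank identities -/

/-- **POS-ONE AT `π²(ξ₀)`, DEPTH ZERO, UNRAMIFIED PLACE — from the index relations `ν(K₀) = (q³+1)·ν(I)`, `ν(K₁) = (q+1)·ν(I)` and the finrank identities
`d₀ = q³`, `d₂ = 1`, `d₁ = 1` (HYPOTHESES; the third brick discharges them)**: the value at one `f 1` of the 3-term EP function is REAL and POSITIVE.
[cite: Rogawski1990, §12.6 p. 187; Prop. 12.6.1 (a) p. 188] [cite: Kottwitz1988, §2] [cite: Tits1979, §3.5] -/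
theorem epValue_re_pos_of_depthZero_pi2 {ν₁ : ℝ} (hν₁ : 0 < ν₁) (q : ℕ) (hq : 2 ≤ q) {d₀ d₂ d₁ : ℕ}
    (hd₀ : d₀ = q ^ 3) (hd₂ : d₂ = 1) (hd₁ : d₁ = 1) {f1 : ℂ}
    (hf1 : f1 = ((((q ^ 3 + 1 : ℕ) : ℝ) * ν₁ : ℝ) : ℂ)⁻¹ * (d₀ : ℂ) + ((((q + 1 : ℕ) : ℝ) * ν₁ : ℝ) : ℂ)⁻¹ * (d₂ : ℂ) - ((ν₁ : ℝ) : ℂ)⁻¹ * (d₁ : ℂ)) :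
    0 < f1.re ∧ f1.im = 0 := by
  refine ⟨(epValue_re_pos_iff_count hν₁ (Nat.succ_pos _) (Nat.succ_pos _) d₀ d₂ d₁ hf1).2 ?_, im_epValue_eq_zero d₀ d₂ d₁ hf1⟩
  subst hd₀ hd₂ hd₁
  exact depthZero_pi2_count q hq

end Summit.HodgeConjecture.HodgeConjecture.Cruxes.H413.K2E3EPFunctionValueAtOneDepthZero
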